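import Literature.IUT.LogVolume.Corollary22PartIIDisplayAt
import HarnessLib

/-!
# [IUTchIV] Corollary 2.2 (ii) from Theorem 1.10's display ONLY INSIDE THE (P1)/(C1) WINDOW `h^{1/2} ≤ l ≤ 10δ·h^{1/2}·log(2δ·h)`
# AND ABOVE THE HEIGHT THRESHOLD `h = log(q^∀) > 2^140` (at one `η_prm`) — the display is consumed nowhere else

Mochizuki, *Inter-universal Teichmüller theory IV*, RIMS manuscript (Apr. 2020; = PRIMS **57** (2021)), Cor. 2.2 (ii), statement
pp. 41–43, proof pp. 43–48: (P1) p. 45 "`(log(q^∀))^{1/2} ≤ l ≤ 10δ·(log(q^∀))^{1/2}·log(2δ·log(q^∀))`", (P7) + "we may apply Theorem 1.10"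
p. 46 l. 1, "`Exc_d`" p. 47. PROOF-ONLY sequel (no definitions, no facts) of abc-iut-S3's `Corollary22PartII.lean` (`partII_of_thm110Legendre`)
and of `Corollary22PartIIDisplayAt.lean` (`partII_of_displayAt`), written for the R-H round-2 seat abc-iut-rh2-q2-cond of the abc-iut cell
(«which error does abc tolerate»: a tolerance may use `log(q) ≤ log(q^∀) ≤ l²`, true only inside the window). TAKES NO SIDE on [IUTchIII]
Cor. 3.12: the disputed chain enters only through the HYPOTHESIS `h110w` (the display), never asserted.

OBSERVATION KERNEL-CHECKED HERE. The printed proof of Cor. 2.2 (ii) applies Theorem 1.10 at ONE prime `l` per curve, the prime of (P1)–(P3)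
(p. 45), hence with `log(q^∀)^{1/2} ≤ l ≤ 10δ·log(q^∀)^{1/2}·log(2δ·log(q^∀))` (`δ = 2^{12}·3^3·5·d`, `d` the degree bound of the statement), and
only at curves outside `Exc_d`, where `log(q^∀) > H_unif·ε_d^{−3}·d^{4+ε_d} + H_K ≥ 2^140`. So the interface `Cor22.Thm110Legendre` (display at
EVERY admissible `(P, l)`) is stronger than what the assembly consumes:
* **`partII_of_displayWindow`** — for ONE `η` with `IsEtaPrm η`: the display `Cor22.Display P l η` demanded ONLY at admissible `(P, l)` with
  `P.degree ≤ d`, `2^140 < log(q^∀(P))`, `log(q^∀)^{1/2} ≤ l ≤ 10δ_d·log(q^∀)^{1/2}·log(2δ_d·log(q^∀))` (for every degree bound `d`), together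
  with `FullGaloisImage`, gives `PartII D (2^140)` for every `K_V` satisfying the hypotheses of Cor. 2.2 — the proof is `partII_of_thm110Legendre`
  VERBATIM, the window facts `hP1lo`, `hP1hi`, `hgt` being in scope at the single invocation of the display;
* `exists_partII_of_displayWindow`, `exists_corollary22_of_displayWindow` — uniform forms.
USE (abc-iut cell, `Summits/ABC/IUTFork/Conditional/AbcOfCor312SlackWindow.lean`): inside the window `log(q^{∤{2,l}}) ≤ log(q^∀) ≤ l²`, so an
error of RELATIVE size `ρ ≤ c·d_mod/l` against the gap `((l+1)/24 − 1/(2l))·log(q)` is an ABSOLUTE error `O(d_mod·l²)`, inside the no-loss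
tolerance of Thm. 1.10 Step (viii). Nothing here asserts Thm. 1.10, Cor. 2.2 or abc; typed ≠ proved.
[cite: Mochizuki2012, IUTchIV Cor. 2.2 (ii) pp. 41–48, (P1) p. 45] [claim: Mochizuki2012, status: disputed]
-/

noncomputable section

namespace Literature.IUT.LogVolume

namespace Cor22

open NumberField IsDedekindDomain Real Polynomial Finset
open Literature.NumberTheory.DiophantineGeometry.GenEll

/-! ## Real arithmetic of the exclusions (the private lemmas of `Corollary22PartII.lean`, restated privately) -/

/-- `ε_d^{−3} ≥ 1` for `0 < ε_d ≤ 1`. [folklore] -/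
private theorem one_le_rpow_neg_three {ε : ℝ} (hε0 : 0 < ε) (hε1 : ε ≤ 1) : 1 ≤ ε ^ (-(3 : ℝ)) := by
  rw [Real.rpow_neg hε0.le]
  exact (one_le_inv₀ (Real.rpow_pos_of_pos hε0 _)).mpr (Real.rpow_le_one hε0.le hε1 (by norm_num))

/-- `d² ≤ d^{4+ε_d}` for `d ≥ 1`, `ε_d > 0`. [folklore] -/
private theorem natCast_sq_le_rpow {d : ℕ} (hd : 1 ≤ d) {ε : ℝ} (hε0 : 0 < ε) : (d : ℝ) ^ 2 ≤ (d : ℝ) ^ (4 + ε) := by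
  have hd1 : (1 : ℝ) ≤ d := by exact_mod_cast hd
  calc (d : ℝ) ^ 2 = (d : ℝ) ^ ((2 : ℕ) : ℝ) := (Real.rpow_natCast _ 2).symm
    _ ≤ (d : ℝ) ^ (4 + ε) := Real.rpow_le_rpow_of_exponent_le hd1 (by push_cast; linarith)

/-- The (P5)-exclusion constant fits the printed shape: `81·δ² ≤ 2^45·ε_d^{−3}·d^{4+ε_d}`. [folklore] -/
private theorem delta_sq_le_shape {d : ℕ} (hd : 1 ≤ d) {ε : ℝ} (hε0 : 0 < ε) (hε1 : ε ≤ 1) :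
    81 * delta d ^ 2 ≤ 2 ^ 45 * (ε ^ (-(3 : ℝ)) * (d : ℝ) ^ (4 + ε)) := by
  unfold delta
  have h1 := one_le_rpow_neg_three hε0 hε1
  have h2 := natCast_sq_le_rpow hd hε0
  have hd0 : (0 : ℝ) ≤ (d : ℝ) ^ 2 := sq_nonneg _
  have h3 : 1 * (d : ℝ) ^ 2 ≤ ε ^ (-(3 : ℝ)) * (d : ℝ) ^ (4 + ε) :=
    mul_le_mul h1 h2 hd0 (le_trans zero_le_one h1)
  calc 81 * (2 ^ 12 * 3 ^ 3 * 5 * (d : ℝ)) ^ 2 = (81 * 552960 ^ 2) * (1 * (d : ℝ) ^ 2) := by ring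
    _ ≤ 2 ^ 45 * (1 * (d : ℝ) ^ 2) := by nlinarith
    _ ≤ 2 ^ 45 * (ε ^ (-(3 : ℝ)) * (d : ℝ) ^ (4 + ε)) := by nlinarith

/-! ## The assembly from the display inside the (P1) window -/

/-- **[IUTchIV] Corollary 2.2 (ii) (pp. 41–43) for `K_V`, PROVED from the display INSIDE THE (P1) WINDOW ONLY** (at one `η_prm` with
`IsEtaPrm η`; the display `Cor22.Display P l η` at admissible `(P, l)` with `P.degree ≤ d`, `2^140 < log(q^∀)`,
`log(q^∀)^{1/2} ≤ l ≤ 10δ_d·log(q^∀)^{1/2}·log(2δ_d·log(q^∀))` — HYPOTHESIS `h110w`, the only place the disputed chain enters) and the classical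
Galois-image input `FullGaloisImage`, with `H_unif := 2^140`, `C_K := 40·η + 2·B_K`. The proof is abc-iut-S3's `partII_of_thm110Legendre`
verbatim; at the single invocation of Theorem 1.10 (p. 46 l. 1) the prime is the (P1)–(P3) prime (`hP1lo`, `hP1hi`) and the curve lies outside
`Exc_d` (`B_d < h`, `B_d ≥ 2^140`). [cite: Mochizuki2012, IUTchIV Cor. 2.2 (ii) pp. 41–48, (P1) p. 45] [claim: Mochizuki2012, status: disputed] -/
theorem partII_of_displayWindow {η : ℝ} (hη : IsEtaPrm η)
    (h110w : ∀ P : NFPoint, P ∈ UP → ∀ d : ℕ, P.degree ≤ d → ∀ l : ℕ, l.Prime → 5 ≤ l →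
      AdmitsCore P → CondP2 P l → CondP5 P l → CondP6 P l →
      (2 : ℝ) ^ 140 < logQForall P → Real.sqrt (logQForall P) ≤ l →
      (l : ℝ) ≤ 10 * delta d * Real.sqrt (logQForall P) * Real.log (2 * delta d * logQForall P) → Display P l η)
    (hFG : FullGaloisImage) (D : CBData) (hD : Hypotheses D) : PartII D (2 ^ 140) := by
  classical
  -- the constants delivered by Cor. 2.2 (i): `B_K` (p. 47) and the height comparison for Northcott
  obtain ⟨h12, h23, h3⟩ := partI_holds D hD
  obtain ⟨B₀, hB₀⟩ := bdEquiv_iff_abs.mp h12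
  set B₁ : ℝ := max B₀ 0 with hB₁def
  have hB₁0 : 0 ≤ B₁ := le_max_right _ _
  have hB₁ : ∀ P ∈ D.toSet, |1 / 6 * logQNotTwo P - 1 / 6 * logQForall P| ≤ B₁ := fun P hP => by
    have hx : |1 / 6 * logQNotTwo P - 1 / 6 * logQForall P| ≤ B₀ := hB₀ P hP
    exact hx.trans (le_max_left _ _)
  obtain ⟨C₀, hC₀⟩ := (h3.symm.trans h23.symm).bdLe
  -- the `H_K` of the classical Galois-image input (the (P4) step, pp. 45–46); `ξ_prm`; `η_prm > 0`
  obtain ⟨G₀, hG₀⟩ := hFG D hD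
  set G : ℝ := max G₀ 0 with hGdef
  have hG0 : 0 ≤ G := le_max_right _ _
  obtain ⟨ξ, hξ⟩ := exists_isXiPrm
  have hξ5 : 5 ≤ ξ := hξ.1
  have hη0 : 0 < η := hη.1
  -- `C_K := 40·η_prm + 2·B_K`, `H_K`
  set HK : ℝ := ξ ^ 2 + 12 * B₁ + G + 13 with hHKdef
  have hHK0 : 0 < HK := by positivity
  refine ⟨CK η B₁, HK, by unfold CK; positivity, hHK0, ?_⟩
  intro d hd εd hεd0 hεd1
  -- the exceptional set
  set X : ℝ := εd ^ (-(3 : ℝ)) * (d : ℝ) ^ (4 + εd) with hXdef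
  have hX0 : 0 ≤ X := mul_nonneg (Real.rpow_nonneg hεd0.le _) (Real.rpow_nonneg (Nat.cast_nonneg _) _)
  set Bd : ℝ := 2 ^ 140 * X + HK with hBddef
  have hBd0 : 0 ≤ Bd := by positivity
  have hBdX : 0 ≤ 2 ^ 140 * X := by positivity
  have hξ2 : (25 : ℝ) ≤ ξ ^ 2 := by nlinarith
  have hBd1 : ξ ^ 2 ≤ Bd := by linarith
  have hBd2 : G < Bd := by linarith
  have hBd3 : 12 * B₁ + 81 * delta d ^ 2 ≤ Bd := by
    have := delta_sq_le_shape hd hεd0 hεd1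
    nlinarith
  have hBd4 : (16 / εd) ^ (3 : ℝ) * (60 * delta d) ^ (4 + εd) ≤ Bd := by
    have := epsE_exclusion_le_shape hd hεd0 hεd1
    nlinarith
  have hBd5 : 12 ≤ Bd := by linarith
  have hX1 : 1 ≤ X := by
    have h1 := one_le_rpow_neg_three hεd0 hεd1
    have h2 : (1 : ℝ) ≤ (d : ℝ) ^ (4 + εd) :=
      Real.one_le_rpow (by exact_mod_cast hd) (by linarith)
    nlinarith
  have hBd6 : 49 < Bd := by nlinarith
  refine ⟨{P | P ∈ D.toSet ∩ UPle d ∧ logQForall P ≤ Bd}, ?_, ?_, ?_, ?_, ?_⟩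
  · -- finiteness: Northcott ([GenEll] Prop. 1.4 (iv)) through (i) `ht ≤ (1/6)·log(q^∀) + C₀` on `K_V`
    refine (northcott_UPle_holds d (1 / 6 * Bd + C₀)).mono ?_
    rintro P ⟨⟨hPD, hPd⟩, hPB⟩
    refine ⟨hPd, ?_⟩
    have hx : NFPoint.ht P - 1 / 6 * logQForall P ≤ C₀ := hC₀ P hPD
    linarith
  · rintro P ⟨⟨_, hPd⟩, _⟩; exact hPd
  · -- `j ∈ {0, 1728}`: `log(q^∀) = 0`
    rintro P hP hj
    exact ⟨hP, by rw [logQForall_eq_zero_of_jInv_zero_or_1728 hj]; exact hBd0⟩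
  · rintro P ⟨_, hPB⟩
    show logQForall P ≤ 2 ^ 140 * εd ^ (-(3 : ℝ)) * (d : ℝ) ^ (4 + εd) + HK
    rw [mul_assoc]; exact hPB
  -- the main case: `x_E ∈ K_V ∩ U_X(ℚ̄)^{≤d}`, `x_E ∉ Exc_d`
  rintro P ⟨hPD, hPd⟩ hPexc
  have hPU : P ∈ UP := hPd.1
  have hPdeg : P.degree ≤ d := hPd.2
  have hInU : P.InU := hPU.1
  set h : ℝ := logQForall P with hhdef
  have hgt : Bd < h := by
    by_contra hle
    exact hPexc ⟨⟨hPD, hPd⟩, not_lt.mp hle⟩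
  have hh0 : 0 ≤ h := logQAvoid_nonneg P ∅
  set s : ℝ := Real.sqrt h with hsdef
  have hs2 : s ^ 2 = h := Real.sq_sqrt hh0
  have hξs : ξ ≤ s := by
    have h1 : Real.sqrt (ξ ^ 2) ≤ Real.sqrt h := Real.sqrt_le_sqrt (by linarith)
    rwa [Real.sqrt_sq (by linarith)] at h1
  have h5s : 5 ≤ s := le_trans hξ5 hξs
  have hδ2 := two_le_delta hd
  have hδ := delta_ge hd
  have hdδ : (P.degree : ℝ) ≤ delta d := by
    have : (P.degree : ℝ) ≤ d := by exact_mod_cast hPdeg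
    unfold delta; nlinarith
  -- the curves without `F`-core are in `Exc_d` (p. 43): `log(q^∀) ≤ 12 ≤ B_d` there
  have hcore : AdmitsCore P := by
    by_contra hno
    have := logQForall_le_of_not_admitsCore hno
    linarith
  -- the prime `l` of (P1), (P2), (P3) (pp. 44–45)
  have hprime : ∃ l : ℕ, l.Prime ∧ Real.sqrt h ≤ l ∧
      (l : ℝ) ≤ 10 * delta d * Real.sqrt h * Real.log (2 * delta d * h) ∧
      (∀ v ∈ badPlaces P, (-(ord P.F v (jInv P.x))).toNat ≠ 0 → ¬ l ∣ (-(ord P.F v (jInv P.x))).toNat) ∧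
      (∀ v ∈ badPlaces P, residueChar P.F v = l →
        (((-(ord P.F v (jInv P.x))).toNat : ℕ) : ℝ) < Real.sqrt h) :=
    PrimeChoiceData.exists_prime_P1_P2_P3
      { ι := HeightOneSpectrum (𝓞 P.F), instDecEq := inferInstance, V := badPlaces P,
        hv := fun v => (-(ord P.F v (jInv P.x))).toNat, fv := resDeg P.F,
        one_le_fv := fun v _ => Nat.one_le_iff_ne_zero.mpr (resDeg_ne_zero P.F v),
        pv := residueChar P.F, pv_prime := fun v _ => residueChar_prime P.F v,
        d := P.degree, one_le_d := P.degree_pos, δ := delta d, two_le_δ := hδ2, d_le_δ := hdδ,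
        h := h, h_def := degree_mul_logQForall_eq_sum P, ξ := ξ, isXiPrm := hξ, ξ_le_sqrt := hξs }
  obtain ⟨l, hlp, hP1lo, hP1hi, hP2, hP3⟩ := hprime
  haveI : Fact l.Prime := ⟨hlp⟩
  -- `l ≥ h^{1/2} > 7` (so `l ≥ 7`: both the `5 ≤ l` of [IUTchI] Def. 3.1 (c) and the `7 ≤ l` form of the
  -- classical Galois-image input are available; `l ≠ 5` as on p. 22)
  have h7s : 7 < s := by
    rw [hsdef, Real.lt_sqrt (by norm_num)]
    linarith
  have h7l : 7 ≤ l := by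
    have : (7 : ℝ) ≤ l := le_trans h7s.le hP1lo
    exact_mod_cast this
  have h5l : 5 ≤ l := le_trans (by norm_num) h7l
  have hl5 : (5 : ℝ) ≤ l := by exact_mod_cast h5l
  have hP2' : CondP2 P l := condP2_of_toNat hP2
  -- consequences of (P3) and (i) (p. 47): `log(q^{∤2}) − log(q) ≤ h^{1/2}·log(l)`, `h − log(q^{∤2}) ≤ 6·B_K`
  have hQ1 : logQNotTwo P - logQAvoid P {2, l} ≤ s * Real.log l := by
    have := logQAvoid_sub_insert_le P {2} hlp (Real.sqrt_nonneg h) (fun v hv hlv =>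
      (hP3 v hv ((mem_placesOver_iff_residueChar v).mp (mem_placesOver_of_natCast_mem l v hlv))).le)
    rwa [Finset.pair_comm] at this
  have hQ2 : h - logQNotTwo P ≤ 6 * B₁ := by
    have := (abs_le.mp (hB₁ P hPD)).1
    linarith
  have hq12 : logQAvoid P {2, l} ≤ logQNotTwo P :=
    logQAvoid_anti P (Finset.singleton_subset_iff.mpr (Finset.mem_insert_self 2 {l}))
  have hq2h : logQNotTwo P ≤ h := logQAvoid_anti P (Finset.empty_subset _)
  -- (P5): `𝕍^bad_mod ≠ ∅` (else `h ≤ 12·B_K + 81·δ² ≤ B_d < h`)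
  have hP5 : CondP5 P l := by
    by_contra hno
    have hq0 := logQAvoid_pair_eq_zero_of_not_condP5 hno
    have hL : (l : ℝ) ≤ 20 * delta d ^ 2 * s ^ 4 := l_le_of_P1 h5s hδ2 (by rw [hs2]; exact hP1hi)
    have hmain : s ^ 2 ≤ 6 * B₁ + s * Real.log l := by rw [hs2]; linarith
    have := h_le_of_no_bad h5s hδ hB₁0 hl5 hL hmain
    rw [hs2] at this
    linarith
  -- (P4) ⇒ (P6): the classical Galois-image input (pp. 45–46), applicable since `h > H_K ≥ G₀`
  have hP6 : CondP6 P l := hG₀ P hPD hPU l hlp (by omega) hP2' hP5 (by linarith [le_max_left G₀ 0])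
  -- (P7) + Theorem 1.10 (p. 46): the HYPOTHESIS, here ONLY at the fixed `η_prm`, INSIDE the (P1) window and above `B_d ≥ 2^140`
  have h140 : (2 : ℝ) ^ 140 < h := by
    have hX' : (2 : ℝ) ^ 140 * 1 ≤ 2 ^ 140 * X := mul_le_mul_of_nonneg_left hX1 (by positivity)
    linarith
  have hdisp : Display P l η := h110w P hPU d hPdeg l hlp (by omega) hcore hP2' hP5 hP6 h140 hP1lo hP1hi
  -- the arithmetic pp. 46–48 (`Corollary22Arithmetic.lean`), with `d*_mod` in the rôle of `e*_mod`
  let A : Data :=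
    { s := s, five_le_s := h5s, δ := delta d, two_le_δ := hδ2, l := l, P1lo := hP1lo,
      P1hi := by rw [hs2]; exact hP1hi,
      L := P.logDiff + logCondAvoid P {2, l},
      L_nonneg := add_nonneg P.logDiff_nonneg (logCondAvoid_nonneg P _),
      η := η, η_nonneg := hη0.le, B := B₁, B_nonneg := hB₁0,
      logq := logQAvoid P {2, l}, logq2 := logQNotTwo P,
      dmod := dmod P, dmod_nonneg := Nat.cast_nonneg _, twenty_dmod_le := twenty_dmod_le P hPdeg,
      estar := 2 ^ 12 * 3 ^ 3 * 5 * (dmod P : ℝ), estar_nonneg := by positivity,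
      estar_le := dstar_le_delta P hPdeg,
      disp := hdisp,
      Q1 := by linarith,
      Q2 := by rw [hs2]; linarith }
  by_cases hε : epsE (delta d) s ≤ 1
  · have hC2 : 1 / 6 * logQAvoid P {2, l} ≤ 1 / 6 * logQNotTwo P ∧ 1 / 6 * logQNotTwo P ≤ 1 / 6 * s ^ 2 ∧
        1 / 6 * s ^ 2 ≤ (1 + epsE (delta d) s) * (P.logDiff + P.logCond) + CK η B₁ :=
      A.condition_C2 hε (logDiffTpd := P.logDiff) (logCondTpd := logCondAvoid P {2, l}) rfl rfl
        (logCondAvoid_le_logCond P hInU _) hq12 (by rw [hs2]; exact hq2h)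
    obtain ⟨c1, c2, c3⟩ := hC2
    have heps : epsilonE d P = epsE (delta d) s := by
      unfold epsilonE epsE
      rw [← hhdef, ← hsdef, hs2]
      ring
    refine ⟨l, hlp, h5l, hP1lo, hP1hi, c1, ?_, ?_⟩
    · rw [hs2] at c2; exact c2
    · rw [heps, ← hhdef, ← hs2]; exact c3
  · -- `ε_E > 1`: excluded (p. 47), `h < (16/ε_d)³·(60δ)^{4+ε_d} ≤ B_d < h`
    exfalso
    rw [not_le] at hε
    have hlt : s ^ 2 < (16 / εd) ^ (3 : ℝ) * (60 * delta d) ^ (4 + εd) := A.h_lt_of_one_lt_epsE hε hεd0 hεd1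
    rw [hs2] at hlt
    linarith

/-- **[IUTchIV] Corollary 2.2 (ii), uniform form, from the display INSIDE THE (P1) WINDOW**: `∃ H_II, ∀ K_V (hypotheses of Cor. 2.2),
PartII K_V H_II` (`H_II = 2^140`). [cite: Mochizuki2012, IUTchIV Cor. 2.2 (ii) pp. 41–48] [claim: Mochizuki2012, status: disputed] -/
theorem exists_partII_of_displayWindow {η : ℝ} (hη : IsEtaPrm η)
    (h110w : ∀ P : NFPoint, P ∈ UP → ∀ d : ℕ, P.degree ≤ d → ∀ l : ℕ, l.Prime → 5 ≤ l →
      AdmitsCore P → CondP2 P l → CondP5 P l → CondP6 P l →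
      (2 : ℝ) ^ 140 < logQForall P → Real.sqrt (logQForall P) ≤ l →
      (l : ℝ) ≤ 10 * delta d * Real.sqrt (logQForall P) * Real.log (2 * delta d * logQForall P) → Display P l η)
    (hFG : FullGaloisImage) : ∃ HII : ℝ, ∀ D : CBData, Hypotheses D → PartII D HII :=
  ⟨2 ^ 140, fun D hD => partII_of_displayWindow hη h110w hFG D hD⟩

/-- **[IUTchIV] Corollary 2.2 from the display INSIDE THE (P1) WINDOW** ((i) and (iii) are theorems of the tree, (ii) by
`partII_of_displayWindow`; `Cor22.exists_corollary22_of_partII`). [cite: Mochizuki2012, IUTchIV Cor. 2.2 pp. 41–48]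
[claim: Mochizuki2012, status: disputed] -/
theorem exists_corollary22_of_displayWindow {η : ℝ} (hη : IsEtaPrm η)
    (h110w : ∀ P : NFPoint, P ∈ UP → ∀ d : ℕ, P.degree ≤ d → ∀ l : ℕ, l.Prime → 5 ≤ l →
      AdmitsCore P → CondP2 P l → CondP5 P l → CondP6 P l →
      (2 : ℝ) ^ 140 < logQForall P → Real.sqrt (logQForall P) ≤ l →
      (l : ℝ) ≤ 10 * delta d * Real.sqrt (logQForall P) * Real.log (2 * delta d * logQForall P) → Display P l η)
    (hFG : FullGaloisImage) : ∃ Hunif : ℝ, Corollary22 Hunif :=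
  exists_corollary22_of_partII fun D hD => partII_of_displayWindow hη h110w hFG D hD

end Cor22

end Literature.IUT.LogVolume

end
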